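/-
Copyright (c) 2026. All rights reserved.
Released under Apache 2.0 license as described in the file LICENSE.
-/
import Literature.AlgebraicGeometry.Pohlmann1968.MultiquadraticCMFieldRankFiveCensus
import Literature.NumberTheory.ComplexMultiplication.DegenerateCMTypesElementaryAbelianTwoGroup
import Literature.NumberTheory.ComplexMultiplication.CMTypeCount
import HarnessLib

/-!
# The CM types of Kubota rank `2` on an elementary abelian `2`-group are the `|G|` sign sets `{χ = ±1}`; a
# multiquadratic CM field of degree `2g` has exactly `2g` CM types of rank `2`, and the rank census in degree `16`
# is `256 = 16 + 112 + 128` (ranks `2`, `5`, `9`)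

SETTING (tree `CMTypeRankCharacters`, T. Kubota [Kubota1965] §4 Lemma 2 = B. B. Gordon [Gordon1999HodgeAVSurvey]
Prop. 9.4.1).  `G` a finite commutative group of exponent `2`, `ρ ∈ G`, `ρ ≠ 1`, `T ⊆ G` a CM type
(`IsCMTypeWith ρ T`), characters `χ : AddChar (Additive G) ℂ` (`±1`-valued; odd when `χ(ρ) = −1`),
`rank(T) = 1 + #{χ odd : Σ_{t ∈ T} χ(t) ≠ 0}`.  The tree (`DegenerateCMTypesElementaryAbelianTwoGroup`,
`ExponentTwo.typeRank_eq_two_iff`, `typeRank_eq_two_iff_exists_subgroup`) knows: `rank(T) = 2` iff some odd character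
is constant on `T`, iff `T` is an index-`2` subgroup `H ∌ ρ` or its complement — on the CM field: iff the type is
lifted from an imaginary quadratic subfield (G. Shimura [Shimura1998] §8.4 Example (2)(A)).  THIS FILE counts:

> **Theorem** (`card_filter_typeRank_eq_two`).  On a finite commutative group `G` of exponent `2`, w.r.t. any
> `ρ ≠ 1`, the CM types of rank `2` are exactly the `|G|` SIGN SETS `{g : χ(g) = s}`, `χ` odd, `s = ±1`
> (`typeRank_eq_two_iff_exists_eq_filter`; distinct pairs `(χ, s)` give distinct sets, `eq_of_filter_apply_eq_eq`):
> **`#{rank 2} = |G|`**.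
> **Theorem** (`ncard_cmTypeRank_eq_two`).  A multiquadratic CM field `K` has exactly `[K:ℚ]` CM types of rank `2`
> (two over each of its `[K:ℚ]/2` imaginary quadratic subfields).
> **Theorem** (`ncard_cmTypeRank_eq_of_finrank_eq_sixteen`).  The `256` CM types of a multiquadratic CM field of
> degree `16` are `16` of rank `2`, `112` of rank `5` and `128` nondegenerate (rank `9`) — with the tree's rank
> spectrum `{2, 5, 9}` (`ExponentTwo.typeRank_mem_of_card_sixteen`), the count `2^{[K:ℚ]/2}` of all CM types
> (`CMTypeCount.natCard_cmType`) and the rank-`5` census (`ncard_cmTypeRank_eq_five_of_finrank_eq_sixteen`).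

* §1 (group level) `isCMTypeWith_filter_apply_eq`, `typeRank_filter_apply_eq` (sign sets are CM types of rank `2`),
  `two_mul_card_filter_apply_eq`, `eq_filter_of_forall_apply_eq`, **`typeRank_eq_two_iff_exists_eq_filter`**,
  `eq_of_filter_apply_eq_eq`, **`card_filter_typeRank_eq_two`**,
  `card_filter_typeRank_eq_two_add_five_of_card_eq_eight` (order `8`: `8 + 8 = 16`, every type has rank `2` or `5`).
* §2 (multiquadratic CM fields) **`ncard_cmTypeRank_eq_two`**, `ncard_cmTypeRank_eq_two_of_finrank_eq_eight / sixteen`,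
  **`ncard_cmTypeRank_eq_of_finrank_eq_sixteen`** (`16 / 112 / 128`), `ncard_isNondegenerate_of_finrank_eq_sixteen`.

HONEST SCOPE.  Elementary counting on the tree's rank-`2` criterion; the numbers are this file's, the sources print
Kubota's formula and the lifted-type dictionary.  THEOREMS ONLY: no definition, no named fact, no instance, no `sorry`.

## References

* [Kubota1965] T. Kubota, *On the field extension by complex multiplication*, Trans. AMS 118 (1965), §2, §4 Lemma 2.
* [Gordon1999HodgeAVSurvey] B. B. Gordon, *A survey of the Hodge conjecture for abelian varieties*, §9.4.1.
* [Shimura1998] G. Shimura, *Abelian Varieties with Complex Multiplication and Modular Functions*, §8.4 Examples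
  (1), (2)(A).
* [Ribet1980] K. A. Ribet, *Division fields of abelian varieties with complex multiplication*, Mém. SMF 2 (1980),
  §3 (3.1) (`2^d` types).
* [Dodson1984] B. Dodson, *The structure of Galois groups of CM-fields*, Trans. AMS 283 (1984), §3.1.1.

## Provenance

Lane `lit-hodgefound` (Track 2, Layer A3/A4), seat `lit-hodgefound-p10` generation 40, row g40-#12; neighbours
cited by name, nothing restated: `DegenerateCMTypesElementaryAbelianTwoGroup` (`ExponentTwo.typeRank_eq_two_iff`,
`typeRank_mem_of_card_sixteen`, `typeRank_eq_five_or_two_of_card_eight`), `CMTypeElementaryTwoGroupOddWeights`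
(`character_apply_eq_one_or_of_mul_self`), `MultiquadraticCMFieldRankFiveCensus` (g40-#11),
`DegenerateCMTypesElementaryAbelianRankFiveCensus` (g40-#10), `CMTypeCount` (`natCard_cmType`, `cmTypeEquivSetPlaces`),
`DegenerateCMTypesCyclicCMFieldPrimeSquare` (`CyclicPrimeSquare.ncard_cmType_sep_eq`),
`DegenerateCMTypesCyclicCMFieldTwoOddPrimes` (`cmTypeRank_eq_typeRank_galType`, `isCMTypeWith_galType`).
-/

open scoped BigOperators NumberField IsMulCommutative Classical
open NumberField Module

namespace Literature.AlgebraicGeometry.Pohlmann1968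

namespace MultiquadraticRankTwoCensus

open Literature.NumberTheory.ComplexMultiplication (typeRank IsCMTypeWith conjGal
  character_apply_eq_one_or_of_mul_self)
open Literature.NumberTheory.ComplexMultiplication.CyclicCMType.ExponentTwo (typeRank_eq_two_iff
  typeRank_mem_of_card_sixteen typeRank_eq_five_or_two_of_card_eight card_filter_typeRank_eq_five_of_card_eq_eight)
open Literature.AlgebraicGeometry.Pohlmann1968.CyclicTwoOddPrimes (isCMTypeWith_galType
  cmTypeRank_eq_typeRank_galType)
open Literature.AlgebraicGeometry.Motives (CMType)

/-! ## §1 Group level: the rank-`2` types are the `|G|` sign sets -/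

section Group

variable {G : Type*} [CommGroup G] [Fintype G] [DecidableEq G] {ρ : G} {T : Finset G}
  {χ : AddChar (Additive G) ℂ} {s : ℂ}

omit [Fintype G] [DecidableEq G] in
/-- `g·g = 1` in exponent `2`. [folklore] -/
private theorem mul_self_eq_one_rt (hexp : ∀ g : G, g ^ 2 = 1) (g : G) : g * g = 1 := by
  rw [← pow_two]; exact hexp g

omit [Fintype G] [DecidableEq G] in
/-- Characters of a group of exponent `2` are `±1`-valued. [folklore] -/
private theorem char_eq_one_or_rt (hexp : ∀ g : G, g ^ 2 = 1) (χ : AddChar (Additive G) ℂ) (g : G) :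
    χ (Additive.ofMul g) = 1 ∨ χ (Additive.ofMul g) = -1 :=
  character_apply_eq_one_or_of_mul_self χ (mul_self_eq_one_rt hexp g)

omit [Fintype G] [DecidableEq G] in
/-- `χ(gh) = χ(g)χ(h)`. [folklore] -/
private theorem char_mul_rt (χ : AddChar (Additive G) ℂ) (g h : G) :
    χ (Additive.ofMul (g * h)) = χ (Additive.ofMul g) * χ (Additive.ofMul h) := by
  rw [ofMul_mul, AddChar.map_add_eq_mul]

/-- `2|T| = |G|` for a CM type. [folklore] -/
private theorem two_mul_card_rt (h : IsCMTypeWith ρ (T : Set G)) : 2 * T.card = Fintype.card G := by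
  have hρ2 : ρ * ρ = 1 := by
    have := h.invol (1 : G)
    simpa [smul_eq_mul] using this
  have hmem : ∀ x : G, ρ * x ∈ T ↔ x ∉ T := fun x => by
    have := h.rho_smul_mem_iff x
    simpa only [smul_eq_mul, Finset.mem_coe] using this
  have hinj : Function.Injective fun s : G => ρ * s := fun a b hab => mul_left_cancel hab
  have hc : Tᶜ = T.image fun s => ρ * s := by
    ext x
    rw [Finset.mem_compl, Finset.mem_image]
    constructor
    · intro hx
      refine ⟨ρ * x, (hmem x).2 hx, ?_⟩
      show ρ * (ρ * x) = x
      rw [← mul_assoc, hρ2, one_mul]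
    · rintro ⟨s, hs, rfl⟩
      exact fun hx => ((hmem s).1 hx) hs
  have h1 : Tᶜ.card = T.card := by rw [hc, Finset.card_image_of_injective _ hinj]
  have h2 := Finset.card_add_card_compl T
  omega

omit [Fintype G] [DecidableEq G] in
/-- **A SIGN SET `{g : χ(g) = s}` OF AN ODD CHARACTER (`s = ±1`) IS A CM TYPE** (`χ(ρg) = −χ(g)`; the case
`s = 1` — the kernel type — is the tree's `ExponentTwo.isCMTypeWith_filter_eq_one` in `DegenerateCMTypesAbelianSwaps`,
outside this file's import cone). [cite: Kubota1965, §2] [cite: Shimura1998, §8.4 Example (2)(A)] -/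
theorem isCMTypeWith_filter_apply_eq [Fintype G] (hexp : ∀ g : G, g ^ 2 = 1) (hχ : χ (Additive.ofMul ρ) = -1)
    (hs : s = 1 ∨ s = -1) :
    IsCMTypeWith ρ (↑(Finset.univ.filter fun g : G => χ (Additive.ofMul g) = s) : Set G) := by
  refine ⟨fun x => ?_, fun g x => ?_, fun x => ?_⟩
  · simp only [Finset.mem_coe, Finset.mem_filter, Finset.mem_univ, true_and, smul_eq_mul, char_mul_rt, hχ]
    rcases char_eq_one_or_rt hexp χ x with e | e <;> rcases hs with rfl | rfl <;> simp only [e] <;> norm_num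
  · simp only [smul_eq_mul]
    rw [mul_left_comm]
  · simp only [smul_eq_mul]
    rw [← mul_assoc, mul_self_eq_one_rt hexp ρ, one_mul]

/-- **A SIGN SET OF AN ODD CHARACTER HAS RANK `2`** (`χ` is constant on it; tree `typeRank_eq_two_iff`).
[cite: Kubota1965, §4 Lemma 2] [cite: Shimura1998, §8.4 Example (2)(A)] -/
theorem typeRank_filter_apply_eq (hexp : ∀ g : G, g ^ 2 = 1) (hχ : χ (Additive.ofMul ρ) = -1)
    (hs : s = 1 ∨ s = -1) :
    typeRank G (↑(Finset.univ.filter fun g : G => χ (Additive.ofMul g) = s) : Set G) = 2 := by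
  refine (typeRank_eq_two_iff hexp (isCMTypeWith_filter_apply_eq hexp hχ hs)).2 ⟨χ, hχ, ?_⟩
  rcases hs with rfl | rfl
  · exact Or.inl fun g hg => (Finset.mem_filter.1 hg).2
  · exact Or.inr fun g hg => (Finset.mem_filter.1 hg).2

/-- A sign set of an odd character has `|G|/2` elements. [cite: Kubota1965, §4 Lemma 2 (proof)] -/
theorem two_mul_card_filter_apply_eq (hexp : ∀ g : G, g ^ 2 = 1) (hχ : χ (Additive.ofMul ρ) = -1)
    (hs : s = 1 ∨ s = -1) :
    2 * (Finset.univ.filter fun g : G => χ (Additive.ofMul g) = s).card = Fintype.card G :=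
  two_mul_card_rt (isCMTypeWith_filter_apply_eq hexp hχ hs)

/-- **A CM type on which an odd character is constant IS the sign set** (both have `|G|/2` elements).
[cite: Kubota1965, §4 Lemma 2] [cite: Shimura1998, §8.4 Example (2)(A)] -/
theorem eq_filter_of_forall_apply_eq (hexp : ∀ g : G, g ^ 2 = 1) (h : IsCMTypeWith ρ (T : Set G))
    (hχ : χ (Additive.ofMul ρ) = -1) (hs : s = 1 ∨ s = -1) (hconst : ∀ t ∈ T, χ (Additive.ofMul t) = s) :
    T = Finset.univ.filter fun g : G => χ (Additive.ofMul g) = s := by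
  refine Finset.eq_of_subset_of_card_le (fun t ht => Finset.mem_filter.2 ⟨Finset.mem_univ _, hconst t ht⟩) ?_
  have h1 := two_mul_card_rt h
  have h2 := two_mul_card_filter_apply_eq hexp hχ hs
  omega

/-- **RANK `2` ⟺ THE TYPE IS A SIGN SET `{g : χ(g) = s}` OF AN ODD CHARACTER** (`s = ±1`).
[cite: Kubota1965, §4 Lemma 2] [cite: Shimura1998, §8.4 Example (2)(A)] -/
theorem typeRank_eq_two_iff_exists_eq_filter (hexp : ∀ g : G, g ^ 2 = 1) (h : IsCMTypeWith ρ (T : Set G)) :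
    typeRank G (T : Set G) = 2 ↔ ∃ χ : AddChar (Additive G) ℂ, χ (Additive.ofMul ρ) = -1 ∧ ∃ s : ℂ,
      (s = 1 ∨ s = -1) ∧ T = Finset.univ.filter fun g : G => χ (Additive.ofMul g) = s := by
  rw [typeRank_eq_two_iff hexp h]
  constructor
  · rintro ⟨χ, hχ, hc | hc⟩
    · exact ⟨χ, hχ, 1, Or.inl rfl, eq_filter_of_forall_apply_eq hexp h hχ (Or.inl rfl) hc⟩
    · exact ⟨χ, hχ, -1, Or.inr rfl, eq_filter_of_forall_apply_eq hexp h hχ (Or.inr rfl) hc⟩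
  · rintro ⟨χ, hχ, s, hs, hT⟩
    refine ⟨χ, hχ, ?_⟩
    rcases hs with rfl | rfl
    · exact Or.inl fun t ht => by rw [hT] at ht; exact (Finset.mem_filter.1 ht).2
    · exact Or.inr fun t ht => by rw [hT] at ht; exact (Finset.mem_filter.1 ht).2

omit [DecidableEq G] in
/-- **Distinct pairs `(χ, s)` give distinct sign sets** (`s` is read off `1 ∈ T`; a `±1`-valued character is
determined by one sign set). [cite: Kubota1965, §4 Lemma 2 (proof)] -/
theorem eq_of_filter_apply_eq_eq (hexp : ∀ g : G, g ^ 2 = 1) {χ χ' : AddChar (Additive G) ℂ} {s s' : ℂ}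
    (hs : s = 1 ∨ s = -1) (hs' : s' = 1 ∨ s' = -1)
    (heq : (Finset.univ.filter fun g : G => χ (Additive.ofMul g) = s) =
      Finset.univ.filter fun g : G => χ' (Additive.ofMul g) = s') :
    χ = χ' ∧ s = s' := by
  have key : ∀ g : G, χ (Additive.ofMul g) = s ↔ χ' (Additive.ofMul g) = s' := fun g => by
    have h1 := Finset.ext_iff.1 heq g
    simpa only [Finset.mem_filter, Finset.mem_univ, true_and] using h1
  have h1 := key 1
  rw [ofMul_one, AddChar.map_zero_eq_one, AddChar.map_zero_eq_one] at h1
  have hss : s = s' := by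
    rcases hs with rfl | rfl <;> rcases hs' with rfl | rfl
    · rfl
    · exact absurd (h1.1 rfl) (by norm_num)
    · exact absurd (h1.2 rfl) (by norm_num)
    · rfl
  subst hss
  refine ⟨?_, rfl⟩
  refine DFunLike.ext χ χ' fun a => ?_
  have k := key (Additive.toMul a)
  rw [ofMul_toMul] at k
  rcases char_eq_one_or_rt hexp χ (Additive.toMul a) with e | e <;>
    rcases char_eq_one_or_rt hexp χ' (Additive.toMul a) with e' | e' <;>
    rw [ofMul_toMul] at e e' <;> rw [e, e'] at k ⊢
  · rcases hs with rfl | rfl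
    · exact absurd (k.1 rfl) (by norm_num)
    · exact absurd (k.2 rfl) (by norm_num)
  · rcases hs with rfl | rfl
    · exact absurd (k.2 rfl) (by norm_num)
    · exact absurd (k.1 rfl) (by norm_num)

/-- **CENSUS OF THE RANK-`2` CM TYPES ON A FINITE COMMUTATIVE GROUP OF EXPONENT `2`**: w.r.t. any `ρ ≠ 1` there
are exactly `|G|` of them (the sign sets `{χ = s}`, `χ` one of the `|G|/2` odd characters, `s = ±1`); on the
field side: a multiquadratic CM field of degree `2g` has `2g` CM types of rank `2`. [cite: Kubota1965, §4 Lemma 2]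
[cite: Shimura1998, §8.4 Example (2)(A)] -/
theorem card_filter_typeRank_eq_two (hexp : ∀ g : G, g ^ 2 = 1) (hρ1 : ρ ≠ 1) :
    ((Finset.univ : Finset (Finset G)).filter fun T : Finset G =>
      IsCMTypeWith ρ (T : Set G) ∧ typeRank G (T : Set G) = 2).card = Fintype.card G := by
  have hρ2 : ρ * ρ = 1 := mul_self_eq_one_rt hexp ρ
  set f : AddChar (Additive G) ℂ × ℂ → Finset G := fun p =>
    Finset.univ.filter fun g : G => p.1 (Additive.ofMul g) = p.2 with hf
  have himage : ((Finset.univ.filter fun χ : AddChar (Additive G) ℂ => χ (Additive.ofMul ρ) = -1) ×ˢ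
      ({1, -1} : Finset ℂ)).image f =
      (Finset.univ : Finset (Finset G)).filter fun T : Finset G =>
        IsCMTypeWith ρ (T : Set G) ∧ typeRank G (T : Set G) = 2 := by
    ext T
    simp only [Finset.mem_image, Finset.mem_product, Finset.mem_filter, Finset.mem_univ, true_and,
      Finset.mem_insert, Finset.mem_singleton, Prod.exists, hf]
    constructor
    · rintro ⟨χ, s, ⟨hχ, hs⟩, rfl⟩
      exact ⟨isCMTypeWith_filter_apply_eq hexp hχ hs, typeRank_filter_apply_eq hexp hχ hs⟩
    · rintro ⟨h, hr⟩
      obtain ⟨χ, hχ, s, hs, hT⟩ := (typeRank_eq_two_iff_exists_eq_filter hexp h).1 hr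
      exact ⟨χ, s, ⟨hχ, hs⟩, hT.symm⟩
  have hinj : Set.InjOn f ↑((Finset.univ.filter fun χ : AddChar (Additive G) ℂ => χ (Additive.ofMul ρ) = -1) ×ˢ
      ({1, -1} : Finset ℂ)) := by
    rintro ⟨χ, s⟩ hp ⟨χ', s'⟩ hp' heq
    simp only [Finset.coe_product, Set.mem_prod, Finset.mem_coe, Finset.mem_filter, Finset.mem_univ, true_and,
      Finset.mem_insert, Finset.mem_singleton] at hp hp'
    simp only [hf] at heq
    obtain ⟨h1, h2⟩ := eq_of_filter_apply_eq_eq hexp hp.2 hp'.2 heq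
    exact Prod.ext h1 h2
  rw [← himage, Finset.card_image_of_injOn hinj, Finset.card_product,
    Finset.card_pair (by norm_num : (1 : ℂ) ≠ -1)]
  have hodd := two_mul_ncard_oddCharacters_eq_card (G := G) hρ1 hρ2
  have hset : {χ : AddChar (Additive G) ℂ | χ (Additive.ofMul ρ) = -1} =
      ↑(Finset.univ.filter fun χ : AddChar (Additive G) ℂ => χ (Additive.ofMul ρ) = -1) := by
    ext χ; simp
  rw [hset, Set.ncard_coe_finset] at hodd
  omega

/-- **Order `8`: `8` types of rank `2` and `8` of rank `5` exhaust the `16` CM types of `(ℤ/2)³`** (every type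
has rank `2` or `5`, tree `typeRank_eq_five_or_two_of_card_eight`). [cite: Kubota1965, §4 Lemma 2]
[cite: Shimura1998, §8.4 Example (1)] -/
theorem card_filter_typeRank_eq_two_add_five_of_card_eq_eight (hexp : ∀ g : G, g ^ 2 = 1) (hρ1 : ρ ≠ 1)
    (h8 : Fintype.card G = 8) :
    ((Finset.univ : Finset (Finset G)).filter fun T : Finset G =>
      IsCMTypeWith ρ (T : Set G) ∧ typeRank G (T : Set G) = 2).card = 8 ∧
    ((Finset.univ : Finset (Finset G)).filter fun T : Finset G =>
      IsCMTypeWith ρ (T : Set G) ∧ typeRank G (T : Set G) = 5).card = 8 ∧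
    ((Finset.univ : Finset (Finset G)).filter fun T : Finset G => IsCMTypeWith ρ (T : Set G)).card = 16 := by
  have h2 := card_filter_typeRank_eq_two hexp hρ1
  have h5 := card_filter_typeRank_eq_five_of_card_eq_eight hexp hρ1 h8
  rw [h8] at h2
  refine ⟨h2, h5, ?_⟩
  have hsplit : ((Finset.univ : Finset (Finset G)).filter fun T : Finset G => IsCMTypeWith ρ (T : Set G)) =
      ((Finset.univ : Finset (Finset G)).filter fun T : Finset G =>
        IsCMTypeWith ρ (T : Set G) ∧ typeRank G (T : Set G) = 2) ∪
      ((Finset.univ : Finset (Finset G)).filter fun T : Finset G =>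
        IsCMTypeWith ρ (T : Set G) ∧ typeRank G (T : Set G) = 5) := by
    ext T
    simp only [Finset.mem_union, Finset.mem_filter, Finset.mem_univ, true_and]
    constructor
    · intro h
      rcases typeRank_eq_five_or_two_of_card_eight hexp h h8 with h5' | h2'
      · exact Or.inr ⟨h, h5'⟩
      · exact Or.inl ⟨h, h2'⟩
    · rintro (⟨h, -⟩ | ⟨h, -⟩) <;> exact h
  rw [hsplit, Finset.card_union_of_disjoint, h2, h5]
  exact Finset.disjoint_filter.2 fun T _ h h' => by omega

end Group

/-! ## §2 Multiquadratic CM fields: `[K:ℚ]` types of rank `2`; the degree-`16` census `16 + 112 + 128` -/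

section Field

variable {K : Type} [Field K] [NumberField K] [IsCMField K] [IsGalois ℚ K]

/-- Transport of a rank count from the Galois group (tree `CyclicPrimeSquare.ncard_cmType_sep_eq`).
[cite: Shimura1998, §8.1 and §18.2 Lemma (i)] -/
private theorem ncard_cmTypeRank_eq_eq_card_filter (hexp : ∀ g : K ≃ₐ[ℚ] K, g ^ 2 = 1) (φ₀ : K →+* ℂ)
    (r : ℕ) :
    {Φ : CMType K | cmTypeRank Φ = r}.ncard =
      ((Finset.univ : Finset (Finset (K ≃ₐ[ℚ] K))).filter fun T : Finset (K ≃ₐ[ℚ] K) =>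
        IsCMTypeWith (conjGal : K ≃ₐ[ℚ] K) (T : Set (K ≃ₐ[ℚ] K)) ∧
          typeRank (K ≃ₐ[ℚ] K) (T : Set (K ≃ₐ[ℚ] K)) = r).card := by
  haveI := Multiquadratic.isAbelianGalois_of_forall_sq_eq_one hexp
  have hρ := AbelianCMFieldExistence.apply_conjGal_eq (K := K) φ₀
  rw [CyclicPrimeSquare.ncard_cmType_sep_eq hρ (fun Φ : CMType K => cmTypeRank Φ = r)
    (fun T : Finset (K ≃ₐ[ℚ] K) => typeRank (K ≃ₐ[ℚ] K) (T : Set (K ≃ₐ[ℚ] K)) = r)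
    (fun Φ => by rw [cmTypeRank_eq_typeRank_galType Φ φ₀])]
  have hset : {ΦG : Finset (K ≃ₐ[ℚ] K) | IsCMTypeWith (conjGal : K ≃ₐ[ℚ] K) (ΦG : Set (K ≃ₐ[ℚ] K)) ∧
      typeRank (K ≃ₐ[ℚ] K) (ΦG : Set (K ≃ₐ[ℚ] K)) = r} =
      ↑((Finset.univ : Finset (Finset (K ≃ₐ[ℚ] K))).filter fun T : Finset (K ≃ₐ[ℚ] K) =>
        IsCMTypeWith (conjGal : K ≃ₐ[ℚ] K) (T : Set (K ≃ₐ[ℚ] K)) ∧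
          typeRank (K ≃ₐ[ℚ] K) (T : Set (K ≃ₐ[ℚ] K)) = r) := by
    ext T; simp
  rw [hset, Set.ncard_coe_finset]

/-- **A MULTIQUADRATIC CM FIELD HAS EXACTLY `[K:ℚ]` CM TYPES OF RANK `2`** (two over each imaginary quadratic
subfield). [cite: Kubota1965, §4 Lemma 2] [cite: Shimura1998, §8.4 Example (2)(A)] -/
theorem ncard_cmTypeRank_eq_two (hexp : ∀ g : K ≃ₐ[ℚ] K, g ^ 2 = 1) (φ₀ : K →+* ℂ) :
    {Φ : CMType K | cmTypeRank Φ = 2}.ncard = finrank ℚ K := by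
  haveI := Multiquadratic.isAbelianGalois_of_forall_sq_eq_one hexp
  have hρ := AbelianCMFieldExistence.apply_conjGal_eq (K := K) φ₀
  rw [ncard_cmTypeRank_eq_eq_card_filter hexp φ₀ 2, ← card_gal_eq_finrank φ₀]
  exact card_filter_typeRank_eq_two hexp (conjGalElt_ne_one hρ)

/-- **Degree `8`: `8` CM types of rank `2`** (and `8` of rank `5`, tree). [cite: Shimura1998, §8.4 Example (1)] -/
theorem ncard_cmTypeRank_eq_two_of_finrank_eq_eight (hexp : ∀ g : K ≃ₐ[ℚ] K, g ^ 2 = 1) (φ₀ : K →+* ℂ)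
    (hK : finrank ℚ K = 8) : {Φ : CMType K | cmTypeRank Φ = 2}.ncard = 8 := by
  rw [ncard_cmTypeRank_eq_two hexp φ₀, hK]

/-- **Degree `16`: `16` CM types of rank `2`.** [cite: Shimura1998, §8.4 Example (1)] -/
theorem ncard_cmTypeRank_eq_two_of_finrank_eq_sixteen (hexp : ∀ g : K ≃ₐ[ℚ] K, g ^ 2 = 1) (φ₀ : K →+* ℂ)
    (hK : finrank ℚ K = 16) : {Φ : CMType K | cmTypeRank Φ = 2}.ncard = 16 := by
  rw [ncard_cmTypeRank_eq_two hexp φ₀, hK]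

/-- **THE RANK CENSUS OF A MULTIQUADRATIC CM FIELD OF DEGREE `16`**: of its `256` CM types, `16` have rank `2`,
`112` rank `5` and `128` rank `9` (nondegenerate) — the rank spectrum being `{2, 5, 9}` (tree
`typeRank_mem_of_card_sixteen`). [cite: Kubota1965, §4 Lemma 2] [cite: Ribet1980, §3 (3.1)]
[cite: Dodson1984, §3.1.1] -/
theorem ncard_cmTypeRank_eq_of_finrank_eq_sixteen (hexp : ∀ g : K ≃ₐ[ℚ] K, g ^ 2 = 1) (φ₀ : K →+* ℂ)
    (hK : finrank ℚ K = 16) :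
    Nat.card (CMType K) = 256 ∧ {Φ : CMType K | cmTypeRank Φ = 2}.ncard = 16 ∧
      {Φ : CMType K | cmTypeRank Φ = 5}.ncard = 112 ∧ {Φ : CMType K | cmTypeRank Φ = 9}.ncard = 128 := by
  haveI : Finite (CMType K) :=
    Finite.of_equiv _ (Literature.NumberTheory.ComplexMultiplication.CMTypeCount.cmTypeEquivSetPlaces (K := K)).symm
  haveI := Multiquadratic.isAbelianGalois_of_forall_sq_eq_one hexp
  have hρ := AbelianCMFieldExistence.apply_conjGal_eq (K := K) φ₀
  have htot : Nat.card (CMType K) = 256 := by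
    rw [Literature.NumberTheory.ComplexMultiplication.CMTypeCount.natCard_cmType, hK]; norm_num
  have h2 := ncard_cmTypeRank_eq_two_of_finrank_eq_sixteen hexp φ₀ hK
  have h5 := ncard_cmTypeRank_eq_five_of_finrank_eq_sixteen hexp φ₀ hK
  refine ⟨htot, h2, h5, ?_⟩
  have hcard : Fintype.card (K ≃ₐ[ℚ] K) = 16 := by rw [card_gal_eq_finrank φ₀, hK]
  -- every type has rank `9`, `5` or `2`
  have hspec : ∀ Φ : CMType K, cmTypeRank Φ = 9 ∨ cmTypeRank Φ = 5 ∨ cmTypeRank Φ = 2 := fun Φ => by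
    rw [cmTypeRank_eq_typeRank_galType Φ φ₀]
    exact typeRank_mem_of_card_sixteen hexp (isCMTypeWith_galType hρ Φ) hcard
  have hunion : (Set.univ : Set (CMType K)) = {Φ : CMType K | cmTypeRank Φ = 9} ∪
      ({Φ : CMType K | cmTypeRank Φ = 5} ∪ {Φ : CMType K | cmTypeRank Φ = 2}) := by
    ext Φ
    simp only [Set.mem_univ, Set.mem_union, Set.mem_setOf_eq, true_iff]
    exact hspec Φ
  have hd1 : Disjoint {Φ : CMType K | cmTypeRank Φ = 9}
      ({Φ : CMType K | cmTypeRank Φ = 5} ∪ {Φ : CMType K | cmTypeRank Φ = 2}) :=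
    Set.disjoint_left.2 fun Φ (h9 : cmTypeRank Φ = 9) h => by
      rcases h with h | h <;> simp only [Set.mem_setOf_eq] at h <;> omega
  have hd2 : Disjoint {Φ : CMType K | cmTypeRank Φ = 5} {Φ : CMType K | cmTypeRank Φ = 2} :=
    Set.disjoint_left.2 fun Φ (h5' : cmTypeRank Φ = 5) (h2' : cmTypeRank Φ = 2) => by omega
  have hsum := Set.ncard_univ (CMType K)
  rw [hunion, Set.ncard_union_eq hd1, Set.ncard_union_eq hd2, h2, h5, htot] at hsum
  omega

/-- **Half of the `256` CM types of a multiquadratic CM field of degree `16` are nondegenerate.**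
[cite: Kubota1965, §4 Lemma 2] [cite: Dodson1984, §3.1.1] -/
theorem ncard_isNondegenerate_of_finrank_eq_sixteen (hexp : ∀ g : K ≃ₐ[ℚ] K, g ^ 2 = 1) (φ₀ : K →+* ℂ)
    (hK : finrank ℚ K = 16) : {Φ : CMType K | IsNondegenerate Φ}.ncard = 128 := by
  have h := (ncard_cmTypeRank_eq_of_finrank_eq_sixteen hexp φ₀ hK).2.2.2
  rw [← h]
  congr 1
  ext Φ
  simp only [Set.mem_setOf_eq]
  rw [_root_.Literature.AlgebraicGeometry.Pohlmann1968.isNondegenerate_iff, hK]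

end Field

end MultiquadraticRankTwoCensus

end Literature.AlgebraicGeometry.Pohlmann1968
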